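import Summits.Ventures.PercRepro.C041TriDomExcessNonneg

/-!
# ROW C-041 — THE EXCESS IS SYMMETRIC IN THE THREE MARKED VERTICES: the anchor plays no role
(p6, gen 41; P6-TWOEXIT-LEAN.md §53)

The excess count `e = N_RRa − N_RB − N_WRj − N_RWj` of a two-exit host (`excess Z₁ u u′ a₁`: anchor `a₁`, exits
`u`, `u′`) is invariant under every permutation of the three marked vertices: exchanging the exits
(`excess_exit_swap`; the type `RB` becomes `BR`, which has the same count by the complementation `tcount_tswap`) and
exchanging the anchor with an exit (`excess_anchor_swap`; the types `RB`, `WRj`, `RWj` become `RWj`, `WBj`, `RB`, and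
`N_WBj = N_WRj` by `tcount_WBj`).  The tools are the symmetry of connectivity (`Mg_symm'`, `Rd_symm'`, from the status
framework) and the relabelling of the status types (`styp_eswap`, `styp_aswap`).  In the three-mark language of §53 this
is the statement that `e = N(⊤,⊥) − Σ (crossed pairs)` is a function of the set `{a₁, u, u′}`.
-/

namespace PercRepro

namespace ZoneZ

namespace MultiExit

open ZoneData Pendant Finset TwoExit TreeClosure RelaxedTriangle

variable {V₁ E₁ U₁ U₂ : Type} (Z₁ : ZoneData V₁ E₁ U₁ U₂) (u u' a₁ : V₁)

/-! ## Symmetry of connectivity -/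

/-- Blue connectivity under a status is symmetric. -/
theorem MgS_symm (st : E₁ → EStat) (ω : E₁ → Bool) {k v : V₁} (h : MgS Z₁ st ω k v) : MgS Z₁ st ω v k :=
  reach_trans_of_symm (BAdjS_symm Z₁ st ω) h (mem_reach_self _ _)

/-- Red connectivity under a status is symmetric. -/
theorem RdS_symm (st : E₁ → EStat) (ω : E₁ → Bool) {k v : V₁} (h : RdS Z₁ st ω k v) : RdS Z₁ st ω v k :=
  reach_trans_of_symm (RAdjS_symm Z₁ st ω) h (mem_reach_self _ _)

/-- The host's blue connectivity is symmetric. -/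
theorem Mg_symm' (k v : V₁) (ω : E₁ → Bool) : Z₁.Mg k v ω ↔ Z₁.Mg v k ω := by
  rw [← MgS_free, ← MgS_free]
  exact ⟨MgS_symm Z₁ _ ω, MgS_symm Z₁ _ ω⟩

/-- The host's red connectivity is symmetric. -/
theorem Rd_symm' (k v : V₁) (ω : E₁ → Bool) : Z₁.Rd k v ω ↔ Z₁.Rd v k ω := by
  rw [← RdS_free, ← RdS_free]
  exact ⟨RdS_symm Z₁ _ ω, RdS_symm Z₁ _ ω⟩

/-! ## Relabelling the status types -/

/-- Exchanging the two exits on a status type. -/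
def eswap (t : Typ) : Typ := (t.2.2.1, t.2.2.2.1, t.1, t.2.1, t.2.2.2.2.1, t.2.2.2.2.2)

/-- `eswap` is an involution. -/
theorem eswap_eswap (t : Typ) : eswap (eswap t) = t := rfl

/-- Exchanging the anchor with the first exit on a status type: `(m, r, m′, r′, b, c) ↦ (m, r, b, c, m′, r′)`. -/
def aswap (t : Typ) : Typ := (t.1, t.2.1, t.2.2.2.2.1, t.2.2.2.2.2, t.2.2.1, t.2.2.2.1)

/-- `aswap` is an involution. -/
theorem aswap_aswap (t : Typ) : aswap (aswap t) = t := rfl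

/-- The status type with the exits exchanged. -/
theorem styp_eswap (ω : E₁ → Bool) : styp Z₁ u' u a₁ ω = eswap (styp Z₁ u u' a₁ ω) := by
  simp only [styp, eswap, Prod.mk.injEq, decide_eq_decide, true_and]
  exact ⟨Mg_symm' Z₁ u' u ω, Rd_symm' Z₁ u' u ω⟩

/-- The status type with the anchor and the first exit exchanged (anchor `u`, exits `a₁`, `u′`). -/
theorem styp_aswap (ω : E₁ → Bool) : styp Z₁ a₁ u' u ω = aswap (styp Z₁ u u' a₁ ω) := by
  simp only [styp, aswap, Prod.mk.injEq, decide_eq_decide, and_true]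
  exact ⟨Mg_symm' Z₁ u a₁ ω, Rd_symm' Z₁ u a₁ ω⟩

variable [Fintype E₁] [DecidableEq E₁]

open Classical in
/-- A type count with the exits exchanged. -/
theorem tcount_eswap (t : Typ) : tcount Z₁ u' u a₁ t = tcount Z₁ u u' a₁ (eswap t) := by
  unfold tcount
  congr 1
  ext ω
  simp only [Finset.mem_filter, Finset.mem_univ, true_and, styp_eswap Z₁ u u' a₁]
  constructor
  · intro h; rw [← h, eswap_eswap]
  · intro h; rw [h, eswap_eswap]

open Classical in
/-- A type count with the anchor and the first exit exchanged. -/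
theorem tcount_aswap (t : Typ) : tcount Z₁ a₁ u' u t = tcount Z₁ u u' a₁ (aswap t) := by
  unfold tcount
  congr 1
  ext ω
  simp only [Finset.mem_filter, Finset.mem_univ, true_and, styp_aswap Z₁ u u' a₁]
  constructor
  · intro h; rw [← h, aswap_aswap]
  · intro h; rw [h, aswap_aswap]

/-! ## The excess is symmetric -/

open Classical in
/-- **THE EXCESS IS SYMMETRIC UNDER THE EXCHANGE OF THE EXITS.** -/
theorem excess_exit_swap : excess Z₁ u' u a₁ = excess Z₁ u u' a₁ := by
  unfold excess
  rw [tcount_eswap Z₁ u u' a₁ (false, true, false, true, false, true),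
    tcount_eswap Z₁ u u' a₁ (false, true, true, false, false, false),
    tcount_eswap Z₁ u u' a₁ (false, false, false, true, true, false),
    tcount_eswap Z₁ u u' a₁ (false, true, false, false, true, false)]
  simp only [eswap]
  have hBR : tcount Z₁ u u' a₁ (true, false, false, true, false, false) =
      tcount Z₁ u u' a₁ (false, true, true, false, false, false) :=
    tcount_tswap Z₁ u u' a₁ (false, true, true, false, false, false)
  rw [hBR]
  ring

open Classical in
/-- **THE EXCESS IS SYMMETRIC UNDER THE EXCHANGE OF THE ANCHOR WITH AN EXIT**: the host with anchor `u` and exits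
`a₁`, `u′` has the same excess. -/
theorem excess_anchor_swap : excess Z₁ a₁ u' u = excess Z₁ u u' a₁ := by
  unfold excess
  rw [tcount_aswap Z₁ u u' a₁ (false, true, false, true, false, true),
    tcount_aswap Z₁ u u' a₁ (false, true, true, false, false, false),
    tcount_aswap Z₁ u u' a₁ (false, false, false, true, true, false),
    tcount_aswap Z₁ u u' a₁ (false, true, false, false, true, false)]
  simp only [aswap]
  rw [tcount_WBj Z₁ u u' a₁]
  ring

open Classical in
/-- The excess with the marks rotated: anchor `u′`, exits `a₁`, `u`. -/
theorem excess_rotate : excess Z₁ a₁ u u' = excess Z₁ u u' a₁ := by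
  rw [← excess_exit_swap Z₁ a₁ u u', excess_anchor_swap Z₁ u' a₁ u, excess_exit_swap Z₁ a₁ u' u,
    excess_anchor_swap Z₁ u u' a₁]

end MultiExit

end ZoneZ

end PercRepro
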